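import Mathlib.MeasureTheory.Group.Action
import Mathlib.MeasureTheory.Group.Measure
import Mathlib.MeasureTheory.Measure.Prod
import Mathlib.MeasureTheory.Measure.OpenPos
import HarnessLib

/-!
# Orbit saturation of null sets with open orbit-sections: a `μ`-null set whose sections along a measure-preserving action of a group with a
# left-invariant open-positive measure are OPEN lies inside an INVARIANT `μ`-null set

Topic `MeasureTheory/Group`; namespace `Literature.MeasureTheory.Group`.  Theorems only (no definition, no named fact, no `sorry`); Mathlib only.

Setting: a group `G` with a measurable structure and an `s`-finite LEFT-invariant measure `ν` that is positive on open sets (e.g. a left Haar measure on a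
locally compact group), acting measurably (`(g, x) ↦ g • x` jointly measurable) on a measurable space `α` with an `s`-finite `G`-invariant measure `μ`
(`SMulInvariantMeasure`).  If `B ⊆ α` is measurable, `μ B = 0`, and every orbit-section `{g | g • x ∈ B}` is OPEN in `G`, then `B` is contained in a measurable,
`μ`-null, `G`-INVARIANT set (`exists_null_invariant_superset_of_isOpen_smul_section`).  Proof (Fubini): `F x := ν {g | g⁻¹ • x ∈ B}` is measurable with
`∫ F dμ = ∫_G μ((g⁻¹ • ·)⁻¹ B) dν = 0`, so `F = 0` a.e.; `F` is `G`-invariant by LEFT-invariance of `ν` (`{g | g⁻¹ • (h • x) ∈ B} = h · {g | g⁻¹ • x ∈ B}`); and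
`B ⊆ {F ≠ 0}` because for `x ∈ B` the open section contains `1`, hence has positive `ν`-measure.  The saturation of a null set is in general NOT null (a null
transversal saturates to everything); openness of the sections is what makes it work.  Corollaries: a function vanishing `μ`-a.e. whose restriction to every
orbit is continuous vanishes identically on every orbit outside an invariant null set (`exists_null_invariant_forall_smul_eq_zero`), also for countable families.

Written for the Hodge-CM cell's regularity road (h) of the spectral-projection letter (D) (`F0/P2/CENSUS-R.v2`, step h3′): pointwise identities (Cauchy–Riemann
germs, weights) that hold a.e. on the automorphic quotient and are continuous along `U(2,1)`-orbits are upgraded to EVERYWHERE after redefining a representative by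
`0` on an invariant null set.  [cite: Folland1995, §2.6 (homogeneous spaces; quasi-invariant measures)] for the Fubini∕invariance bookkeeping; the statement itself is folklore.

## References
* [Folland1995] G. B. Folland, *A Course in Abstract Harmonic Analysis* (1995), §2.6, §2.7 (invariant measures on homogeneous spaces; Fubini on `G × G/H`).
* [BorelJacquet1979] A. Borel, H. Jacquet, Corvallis PSPM 33.1 (1979), §4.6 (the `L²` automorphic setting where this is used).
-/

noncomputable section

open MeasureTheory Set
open scoped ENNReal Pointwise

namespace Literature.MeasureTheory.Group

section Saturation

variable {G : Type*} [Group G] [MeasurableSpace G] {α : Type*} [MeasurableSpace α] [MulAction G α]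

/-- The orbit-sections `{g | g⁻¹ • x ∈ B}` are the horizontal sections of the measurable set `{(x, g) | g⁻¹ • x ∈ B}`; hence `x ↦ ν {g | g⁻¹ • x ∈ B}` is MEASURABLE
(`measurable_measure_prodMk_left`) when `(g, x) ↦ g • x` is jointly measurable. [cite: Folland1995, §2.6] -/
theorem measurable_measure_inv_smul_section [MeasurableInv G] (ν : Measure G) [SFinite ν] (hact : Measurable fun p : G × α => p.1 • p.2)
    {B : Set α} (hB : MeasurableSet B) : Measurable fun x : α => ν {g : G | g⁻¹ • x ∈ B} := by
  have hS : MeasurableSet {p : α × G | p.2⁻¹ • p.1 ∈ B} :=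
    (hact.comp (Measurable.prodMk (measurable_snd.inv) measurable_fst)) hB
  exact measurable_measure_prodMk_left hS

/-- **Fubini**: `∫⁻_α ν{g | g⁻¹ • x ∈ B} dμ = (μ ⊗ ν){(x,g) | g⁻¹ • x ∈ B} = ∫⁻_G μ((g⁻¹ • ·)⁻¹ B) dν = 0` when `μ B = 0` and `μ` is `G`-invariant.
[cite: Folland1995, §2.6] -/
theorem lintegral_measure_inv_smul_section_eq_zero [MeasurableInv G] (ν : Measure G) [SFinite ν] (μ : Measure α) [SFinite μ]
    [SMulInvariantMeasure G α μ] (hact : Measurable fun p : G × α => p.1 • p.2) {B : Set α} (hB : MeasurableSet B) (hμB : μ B = 0) :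
    ∫⁻ x, ν {g : G | g⁻¹ • x ∈ B} ∂μ = 0 := by
  have hS : MeasurableSet {p : α × G | p.2⁻¹ • p.1 ∈ B} :=
    (hact.comp (Measurable.prodMk (measurable_snd.inv) measurable_fst)) hB
  have h1 : ∫⁻ x, ν {g : G | g⁻¹ • x ∈ B} ∂μ = μ.prod ν {p : α × G | p.2⁻¹ • p.1 ∈ B} :=
    (Measure.prod_apply hS).symm
  rw [h1, Measure.prod_apply_symm hS]
  have h2 : ∀ g : G, μ ((fun x : α => (x, g)) ⁻¹' {p : α × G | p.2⁻¹ • p.1 ∈ B}) = 0 :=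
    fun g => measure_preimage_smul_null hμB g⁻¹
  simp only [h2, lintegral_zero]

/-- **ORBIT SATURATION OF A NULL SET WITH OPEN SECTIONS.**  `ν` an `s`-finite LEFT-invariant measure on `G` positive on open sets (e.g. a left Haar measure), `μ` an `s`-finite
`G`-invariant measure on `α`, the action jointly measurable.  If `B` is measurable, `μ`-null, and every section `{g | g • x ∈ B}` is OPEN, then `B ⊆ N` for a measurable, `μ`-null,
`G`-INVARIANT `N` (`h • x ∈ N ↔ x ∈ N`): `N := {x | ν{g | g⁻¹ • x ∈ B} ≠ 0}` — null by Fubini, invariant by LEFT-invariance of `ν`, and `⊇ B` because the section at `x ∈ B` is an open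
neighbourhood of `1`. [cite: Folland1995, §2.6] -/
theorem exists_null_invariant_superset_of_isOpen_smul_section [TopologicalSpace G] [MeasurableMul G] [MeasurableInv G] [ContinuousInv G]
    (ν : Measure G) [SFinite ν] [ν.IsMulLeftInvariant] [ν.IsOpenPosMeasure] (μ : Measure α) [SFinite μ] [SMulInvariantMeasure G α μ]
    (hact : Measurable fun p : G × α => p.1 • p.2) {B : Set α} (hB : MeasurableSet B) (hμB : μ B = 0) (hopen : ∀ x : α, IsOpen {g : G | g • x ∈ B}) :
    ∃ N : Set α, MeasurableSet N ∧ μ N = 0 ∧ B ⊆ N ∧ ∀ (h : G) (x : α), h • x ∈ N ↔ x ∈ N := by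
  set F : α → ℝ≥0∞ := fun x => ν {g : G | g⁻¹ • x ∈ B} with hF
  have hFm : Measurable F := measurable_measure_inv_smul_section ν hact hB
  refine ⟨{x | F x ≠ 0}, hFm (measurableSet_singleton 0).compl, ?_, ?_, ?_⟩
  · -- `F = 0` a.e.
    have h0 : ∫⁻ x, F x ∂μ = 0 := lintegral_measure_inv_smul_section_eq_zero ν μ hact hB hμB
    have hae : F =ᵐ[μ] 0 := (lintegral_eq_zero_iff hFm).mp h0
    rw [Filter.EventuallyEq, ae_iff] at hae
    simpa using hae
  · -- `B ⊆ N`: the section at `x ∈ B` is an open set containing `1`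
    intro x hx
    have hopen' : IsOpen {g : G | g⁻¹ • x ∈ B} := (hopen x).preimage continuous_inv
    exact (hopen'.measure_pos ν ⟨1, by simpa using hx⟩).ne'
  · -- invariance, by LEFT-invariance of `ν`
    intro h x
    simp only [Set.mem_setOf_eq, hF]
    have hset : {g : G | g⁻¹ • h • x ∈ B} = (fun g => h⁻¹ * g) ⁻¹' {g : G | g⁻¹ • x ∈ B} := by
      ext g
      simp only [Set.mem_setOf_eq, Set.mem_preimage, mul_inv_rev, inv_inv, mul_smul]
    rw [hset, measure_preimage_mul]

/-- **A.e.-vanishing + continuity along orbits ⟹ vanishing on every orbit off an invariant null set.**  For `D : α → E` with `{x | D x ≠ 0}` measurable and `μ`-null and every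
orbit map `g ↦ D (g • x)` continuous, there is a measurable `μ`-null `G`-invariant `N` with `D (g • x) = 0` for all `g`, for every `x ∉ N`. [cite: Folland1995, §2.6] -/
theorem exists_null_invariant_forall_smul_eq_zero [TopologicalSpace G] [MeasurableMul G] [MeasurableInv G] [ContinuousInv G]
    (ν : Measure G) [SFinite ν] [ν.IsMulLeftInvariant] [ν.IsOpenPosMeasure] (μ : Measure α) [SFinite μ] [SMulInvariantMeasure G α μ]
    {E : Type*} [Zero E] [TopologicalSpace E] [T1Space E]
    (hact : Measurable fun p : G × α => p.1 • p.2) {D : α → E} (hDm : MeasurableSet {x | D x ≠ 0}) (hD0 : μ {x | D x ≠ 0} = 0)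
    (hcont : ∀ x : α, Continuous fun g : G => D (g • x)) :
    ∃ N : Set α, MeasurableSet N ∧ μ N = 0 ∧ (∀ (h : G) (x : α), h • x ∈ N ↔ x ∈ N) ∧ ∀ x ∉ N, ∀ g : G, D (g • x) = 0 := by
  obtain ⟨N, hNm, hN0, hBN, hinv⟩ := exists_null_invariant_superset_of_isOpen_smul_section ν μ hact hDm hD0
    (fun x => (isOpen_compl_singleton (x := (0 : E))).preimage (hcont x))
  refine ⟨N, hNm, hN0, hinv, fun x hx g => ?_⟩
  by_contra hne
  exact hx ((hinv g x).mp (hBN hne))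

/-- **Countable family version**: one invariant null set off which EVERY `D i` vanishes on every orbit. [cite: Folland1995, §2.6] -/
theorem exists_null_invariant_forall_smul_eq_zero_countable [TopologicalSpace G] [MeasurableMul G] [MeasurableInv G] [ContinuousInv G]
    (ν : Measure G) [SFinite ν] [ν.IsMulLeftInvariant] [ν.IsOpenPosMeasure] (μ : Measure α) [SFinite μ] [SMulInvariantMeasure G α μ]
    {ι : Type*} [Countable ι] {E : Type*} [Zero E] [TopologicalSpace E] [T1Space E]
    (hact : Measurable fun p : G × α => p.1 • p.2) {D : ι → α → E} (hDm : ∀ i, MeasurableSet {x | D i x ≠ 0})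
    (hD0 : ∀ i, μ {x | D i x ≠ 0} = 0) (hcont : ∀ i (x : α), Continuous fun g : G => D i (g • x)) :
    ∃ N : Set α, MeasurableSet N ∧ μ N = 0 ∧ (∀ (h : G) (x : α), h • x ∈ N ↔ x ∈ N) ∧ ∀ x ∉ N, ∀ (i : ι) (g : G), D i (g • x) = 0 := by
  choose N hNm hN0 hinv hvan using fun i => exists_null_invariant_forall_smul_eq_zero ν μ hact (hDm i) (hD0 i) (hcont i)
  refine ⟨⋃ i, N i, MeasurableSet.iUnion hNm, measure_iUnion_null hN0, fun h x => ?_, fun x hx i g => ?_⟩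
  · simp only [Set.mem_iUnion]
    exact exists_congr fun i => hinv i h x
  · exact hvan i x (fun hxi => hx (Set.mem_iUnion.mpr ⟨i, hxi⟩)) g

end Saturation

end Literature.MeasureTheory.Group

end
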